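import Summits.CriticalPhenomena.PercolationContinuityZ3.Theorems.Transplant.FKDoubleFanOneSidedConeS
import HarnessLib

/-!
# Double fans `K₂ ∨ P_{m+1}`: a FACE of the `a`-sided cone, and TANGENT ATOMS (polarisations at vanishing images lie in the closed cone)

Helper file (`--supports stmt-CriticalPhenomena-4575`), FK sub-lane `prim-bschramm-fk-3` (gen 38); builds on p205010 (kernel theorem, internal audit
signed; external expert review pending).  No named facts, no sorries; standard axioms.  Memo `bschramm/prim-bschramm-fk-3/FAR-CROSS-XIII.md` §3–§4.

Two exact structural facts about `osConeS q` (`…OneSidedConeS`), both used to organise certificates of the cell memberships of `…ConeSCells`: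

1. **A supporting hyperplane.**  With **`gammaFace q`** `:= (1, −1, −1, 1−q, 0, −(2−q), 0, 2−q, 0, (1−q)(2−q))` one has, for EVERY gadget `F` and
   rest `w` (no validity needed), **`pairH_imgA_gammaFace`**:
   `⟪imgA q F w, γ_face⟫ = (1−q)²(2−q)·F_ac·w_bc·[(F_ac+F_bc+F₁)(|w| + ŷ(w)) + 2(F₀+F_ab)·ŷ(w)] ≥ 0`,
   i.e. `γ_face ∈ OSDualS q` for `q ≤ 1` (**`oSDualS_gammaFace`**): in Plücker coordinates the functional is the decomposable 2-form
   `(e_u − e_z) ∧ (e_x − e_y − e_z − e_v)`, and the second factor of every `a`-image lies in the kernel of `e_u − e_z`.  The exposed face consists of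
   the images with `F_ac = 0` or `w_bc = 0`.  The fixed vector `(C, 0, 0, C+1, −C, −(C+1), 0, 0, C+1, C+2)` of the shifted degenerate-gadget cell
   (`…ConeSShiftCells`, hypothesis `h_cut`) lies ON this hyperplane for every `C` (**`pairH_cutShift_gammaFace`**): its membership in the cone is tight,
   so any certificate for it must be exact (numerically it is realised only by limits of nearly degenerate images, kit j272343).
2. **Tangent atoms.**  `imgA` is quadratic in the gadget and in the rest; the polarisations **`bilF`**, **`bilW`** satisfy the exact expansions
   **`imgA_gadget_line`**, **`imgA_rest_line`** (`imgA (F + εF') w = imgA F w + ε·bilF + ε²·imgA F' w`, and the same in the rest).  Since the cone is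
   a bi-dual it is closed under the elementary limit **`mem_osConeS_of_eps`** (`ε·β₁ + ε²·β₂ ∈ K` for all `ε ∈ (0,1]` ⟹ `β₁ ∈ K`); hence at a pair with
   VANISHING image, the polarisation towards any direction that keeps the pair in `InS` lies in the cone (**`bilF_mem_osConeS`**, **`bilW_mem_osConeS`**).
   These tangent atoms are not `a`-images themselves; numerically they are exactly the extra generators needed to decompose the boundary targets of
   the shifted cells (memo §4).
[folklore]
-/

noncomputable section

namespace Summit.CriticalPhenomena.PercolationContinuityZ3.Theorems

namespace FK

namespace ThreeApex

/-! ### The face functional -/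

/-- The face functional `γ_face` (pairing with it is `(1−q)²(2−q)` times the 2-form `(e_u − e_z) ∧ (e_x − e_y − e_z − e_v)`). [folklore] -/
def gammaFace (q : ℝ) : Biv := ⟨1, -1, -1, 1 - q, 0, -(2 - q), 0, 2 - q, 0, (1 - q) * (2 - q)⟩

/-- The pairing with `γ_face` in Plücker coordinates. [folklore] -/
theorem pairH_gammaFace (q : ℝ) (β : Biv) :
    pairH q β (gammaFace q) = (1 - q) ^ 2 * (2 - q) * (β.ux - β.uy - β.uz - β.uv + β.xz - β.yz + β.zv) := by
  simp only [pairH, gammaFace]; ring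

/-- **The face identity**: `⟪imgA q F w, γ_face⟫ = (1−q)²(2−q)·F_ac·w_bc·[(F_ac + F_bc + F₁)(|w| + ŷ w) + 2(F₀ + F_ab)·ŷ w]`. [folklore] -/
theorem pairH_imgA_gammaFace (q : ℝ) (F w : V5) :
    pairH q (imgA q F w) (gammaFace q) =
      (1 - q) ^ 2 * (2 - q) * (F.zac * w.zbc * ((F.zac + F.zbc + F.z1) * (w.total + hy w) + 2 * (F.z0 + F.zab) * hy w)) := by
  simp only [pairH, gammaFace, imgA, wedgeH, fanCombo, conv, edgeAC, detach, V5.total, hx, hy, hz]; ring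

/-- **`γ_face` is a valid inequality on every `a`-image with non-negative masses** (`q ≤ 1`). [folklore] -/
theorem pairH_imgA_gammaFace_nonneg {q : ℝ} (hq1 : q ≤ 1) {F w : V5} (hF : F.Nonneg) (hw : w.Nonneg) :
    0 ≤ pairH q (imgA q F w) (gammaFace q) := by
  rw [pairH_imgA_gammaFace]
  obtain ⟨f0, fab, fac, fbc, f1⟩ := hF
  obtain ⟨w0, wab, wac, wbc, w1⟩ := hw
  have h1 : 0 ≤ 1 - q := sub_nonneg.2 hq1
  have h2 : 0 ≤ 2 - q := by linarith
  have ht : 0 ≤ w.total := by simp only [V5.total]; positivity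
  have hyw : 0 ≤ hy w := by simp only [hy]; positivity
  positivity

/-- **`γ_face ∈ OSDualS q`** (`q ≤ 1`). [folklore] -/
theorem oSDualS_gammaFace {q : ℝ} (hq1 : q ≤ 1) : OSDualS q (gammaFace q) :=
  fun _ _ hF hw => pairH_imgA_gammaFace_nonneg hq1 hF.valid.nonneg hw.valid.nonneg

/-- **The shifted cut vector lies on the face**: `⟪(C, 0, 0, C+1, −C, −(C+1), 0, 0, C+1, C+2), γ_face⟫ = 0` for every `C`. [folklore] -/
theorem pairH_cutShift_gammaFace (q C : ℝ) :
    pairH q (⟨C, 0, 0, C + 1, -C, -(C + 1), 0, 0, C + 1, C + 2⟩ : Biv) (gammaFace q) = 0 := by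
  rw [pairH_gammaFace]; ring

/-- Every element of the cone pairs non-negatively with `γ_face` (`q ≤ 1`): the half-space `{⟪·, γ_face⟫ ≥ 0}` contains `osConeS q`. [folklore] -/
theorem pairH_gammaFace_nonneg_of_mem {q : ℝ} (hq1 : q ≤ 1) {β : Biv} (hβ : β ∈ osConeS q) : 0 ≤ pairH q β (gammaFace q) :=
  hβ _ (oSDualS_gammaFace hq1)

/-! ### Polarisations of the image -/

/-- Two-term combination of fibre-mass vectors. [folklore] -/
def V5.lin2 (a : ℝ) (F : V5) (b : ℝ) (G : V5) : V5 :=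
  ⟨a * F.z0 + b * G.z0, a * F.zab + b * G.zab, a * F.zac + b * G.zac, a * F.zbc + b * G.zbc, a * F.z1 + b * G.z1⟩

/-- The polarisation of `imgA` in the gadget: `F ↦ imgA q F w` is quadratic, with bilinear part `bilF`. [folklore] -/
def bilF (q : ℝ) (F F' w : V5) : Biv :=
  Biv.add (wedgeH (fanCombo q F (conv (edgeAC 0) w)) (fanCombo q F' (conv (edgeAC 1) w)))
    (wedgeH (fanCombo q F' (conv (edgeAC 0) w)) (fanCombo q F (conv (edgeAC 1) w)))

/-- The polarisation of `imgA` in the rest. [folklore] -/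
def bilW (q : ℝ) (F w δ : V5) : Biv :=
  Biv.add (wedgeH (fanCombo q F (conv (edgeAC 0) w)) (fanCombo q F (conv (edgeAC 1) δ)))
    (wedgeH (fanCombo q F (conv (edgeAC 0) δ)) (fanCombo q F (conv (edgeAC 1) w)))

/-- **Gadget line**: `imgA q (F + εF') w = imgA q F w + ε·bilF q F F' w + ε²·imgA q F' w`. [folklore] -/
theorem imgA_gadget_line (q ε : ℝ) (F F' w : V5) :
    imgA q (V5.lin2 1 F ε F') w = Biv.lin3 1 (imgA q F w) ε (bilF q F F' w) (ε ^ 2) (imgA q F' w) := by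
  ext <;> simp only [imgA, bilF, V5.lin2, wedgeH, fanCombo, conv, edgeAC, detach, V5.total, hx, hy, hz, Biv.lin3, Biv.add, Biv.smul] <;> ring

set_option maxHeartbeats 400000 in
/-- **Rest line**: `imgA q F (w + εδ) = imgA q F w + ε·bilW q F w δ + ε²·imgA q F δ`. [folklore] -/
theorem imgA_rest_line (q ε : ℝ) (F w δ : V5) :
    imgA q F (V5.lin2 1 w ε δ) = Biv.lin3 1 (imgA q F w) ε (bilW q F w δ) (ε ^ 2) (imgA q F δ) := by
  ext <;> simp only [imgA, bilW, V5.lin2, wedgeH, fanCombo, conv, edgeAC, detach, V5.total, hx, hy, hz, Biv.lin3, Biv.add, Biv.smul] <;> ring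

/-! ### The limit lemma and tangent atoms -/

/-- **Limit lemma**: if `ε·β₁ + ε²·β₂ ∈ osConeS q` for every `ε ∈ (0,1]`, then `β₁ ∈ osConeS q` (the bi-dual is closed). [folklore] -/
theorem mem_osConeS_of_eps {q : ℝ} {β₁ β₂ : Biv}
    (h : ∀ ε : ℝ, 0 < ε → ε ≤ 1 → Biv.add (Biv.smul ε β₁) (Biv.smul (ε ^ 2) β₂) ∈ osConeS q) : β₁ ∈ osConeS q := by
  intro γ hγ
  set a := pairH q β₁ γ with ha
  set b := pairH q β₂ γ with hb
  have key : ∀ ε : ℝ, 0 < ε → ε ≤ 1 → 0 ≤ a + ε * b := by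
    intro ε hε0 hε1
    have h1 := h ε hε0 hε1 γ hγ
    rw [pairH_add_left, pairH_smul_left, pairH_smul_left, ← ha, ← hb] at h1
    have e : ε * a + ε ^ 2 * b = ε * (a + ε * b) := by ring
    rw [e] at h1
    exact (mul_nonneg_iff_of_pos_left hε0).1 h1
  by_contra hneg
  rw [not_le] at hneg
  set ε : ℝ := min 1 (-a / (2 * (|b| + 1))) with hε
  have hbp : 0 < |b| + 1 := by positivity
  have hε0 : 0 < ε := by
    rw [hε, lt_min_iff]; exact ⟨one_pos, div_pos (by linarith) (by positivity)⟩
  have hε1 : ε ≤ 1 := min_le_left _ _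
  have hε2 : ε ≤ -a / (2 * (|b| + 1)) := min_le_right _ _
  have h3 : ε * b ≤ ε * |b| := mul_le_mul_of_nonneg_left (le_abs_self b) hε0.le
  have h4 : ε * |b| ≤ -a / (2 * (|b| + 1)) * |b| := mul_le_mul_of_nonneg_right hε2 (abs_nonneg b)
  have h5 : -a / (2 * (|b| + 1)) * |b| ≤ -a / 2 := by
    rw [div_mul_eq_mul_div, div_le_div_iff₀ (by positivity) (by norm_num)]
    nlinarith [abs_nonneg b]
  have := key ε hε0 hε1
  linarith

/-- **Gadget tangent atoms**: if the image of `(F, w)` vanishes, `w ∈ InS q`, and `F + εF' ∈ InS q` for all `ε ∈ (0,1]`, then the polarisation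
`bilF q F F' w` lies in the cone. [folklore] -/
theorem bilF_mem_osConeS {q : ℝ} {F F' w : V5} (h0 : imgA q F w = ⟨0, 0, 0, 0, 0, 0, 0, 0, 0, 0⟩) (hw : InS q w)
    (hline : ∀ ε : ℝ, 0 < ε → ε ≤ 1 → InS q (V5.lin2 1 F ε F')) : bilF q F F' w ∈ osConeS q := by
  refine mem_osConeS_of_eps (β₂ := imgA q F' w) fun ε hε0 hε1 => ?_
  have hm := imgA_mem_osConeS (hline ε hε0 hε1) hw
  rw [imgA_gadget_line, h0] at hm
  have e : Biv.lin3 1 (⟨0, 0, 0, 0, 0, 0, 0, 0, 0, 0⟩ : Biv) ε (bilF q F F' w) (ε ^ 2) (imgA q F' w) =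
      Biv.add (Biv.smul ε (bilF q F F' w)) (Biv.smul (ε ^ 2) (imgA q F' w)) := by
    ext <;> simp [Biv.lin3, Biv.add, Biv.smul]
  rwa [e] at hm

/-- **Rest tangent atoms**: if the image of `(F, w)` vanishes, `F ∈ InS q`, and `w + εδ ∈ InS q` for all `ε ∈ (0,1]`, then the polarisation
`bilW q F w δ` lies in the cone. [folklore] -/
theorem bilW_mem_osConeS {q : ℝ} {F w δ : V5} (h0 : imgA q F w = ⟨0, 0, 0, 0, 0, 0, 0, 0, 0, 0⟩) (hF : InS q F)
    (hline : ∀ ε : ℝ, 0 < ε → ε ≤ 1 → InS q (V5.lin2 1 w ε δ)) : bilW q F w δ ∈ osConeS q := by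
  refine mem_osConeS_of_eps (β₂ := imgA q F δ) fun ε hε0 hε1 => ?_
  have hm := imgA_mem_osConeS hF (hline ε hε0 hε1)
  rw [imgA_rest_line, h0] at hm
  have e : Biv.lin3 1 (⟨0, 0, 0, 0, 0, 0, 0, 0, 0, 0⟩ : Biv) ε (bilW q F w δ) (ε ^ 2) (imgA q F δ) =
      Biv.add (Biv.smul ε (bilW q F w δ)) (Biv.smul (ε ^ 2) (imgA q F δ)) := by
    ext <;> simp [Biv.lin3, Biv.add, Biv.smul]
  rwa [e] at hm

/-- The image of the `a`-pinning gadget `P_a = (0,0,0,0,1)` vanishes at every rest (both factors equal `P_a w`). [folklore] -/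
theorem imgA_pinA_eq_zero (q : ℝ) (w : V5) : imgA q ⟨0, 0, 0, 0, 1⟩ w = ⟨0, 0, 0, 0, 0, 0, 0, 0, 0, 0⟩ := by
  ext <;> simp only [imgA, wedgeH, fanCombo, conv, edgeAC, detach, V5.total, hx, hy, hz] <;> ring

/-- The image of the gadget `D ∘ P_a = (0,1,0,0,0)` vanishes at every rest. [folklore] -/
theorem imgA_detachPinA_eq_zero (q : ℝ) (w : V5) : imgA q ⟨0, 1, 0, 0, 0⟩ w = ⟨0, 0, 0, 0, 0, 0, 0, 0, 0, 0⟩ := by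
  ext <;> simp only [imgA, wedgeH, fanCombo, conv, edgeAC, detach, V5.total, hx, hy, hz] <;> ring

/-- The image of every gadget vanishes at a rest fixed by the `a`-pinning (`Z₀ = Z_ab = Z_bc = 0`). [folklore] -/
theorem imgA_fixedRest_eq_zero (q : ℝ) (F : V5) (yac y1 : ℝ) : imgA q F ⟨0, 0, yac, 0, y1⟩ = ⟨0, 0, 0, 0, 0, 0, 0, 0, 0, 0⟩ := by
  ext <;> simp only [imgA, wedgeH, fanCombo, conv, edgeAC, detach, V5.total, hx, hy, hz] <;> ring

/-! ### The contraction with `e_u − e_z`: four coordinate functionals, eight dual elements (appended, gen 38) -/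

/-- The contraction of an `a`-image with the covector `e_u − e_z` is `−F_ac·w_bc·X₁`, `X₁ = Comb(F)(P_a w)`, whose coordinates in the basis
`(e_u+e_z, e_x, e_y, e_v)` are `F_ac w_bc·(μ ŷ, μ |w|, (λ+μ) ŷ, (λ+μ)|w|)`, `μ = F₀ + F_ab`, `λ = F_ac + F_bc + F₁`.  The four coordinates as
`pairH`-dual vectors: the `(e_u+e_z)`-coordinate. [folklore] -/
def gammaPE : Biv := ⟨0, 0, -1, 0, 0, 0, 0, 0, 0, 0⟩

/-- The `e_x`-coordinate of the contraction, as a dual vector. [folklore] -/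
def gammaPX (q : ℝ) : Biv := ⟨-1, 0, 0, 0, 0, 2 - q, 0, 0, 0, 0⟩

/-- The `e_y`-coordinate of the contraction, as a dual vector. [folklore] -/
def gammaPY (q : ℝ) : Biv := ⟨0, -1, 0, 0, 0, 0, 0, 2 - q, 0, 0⟩

/-- The `e_v`-coordinate of the contraction, as a dual vector. [folklore] -/
def gammaPV (q : ℝ) : Biv := ⟨0, 0, 0, 1 - q, 0, 0, 0, 0, 0, (1 - q) * (2 - q)⟩

/-- `⟪β, γ_PE⟫ = −(1−q)²(2−q)·β_uz`. [folklore] -/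
theorem pairH_gammaPE (q : ℝ) (β : Biv) : pairH q β gammaPE = (1 - q) ^ 2 * (2 - q) * (-β.uz) := by
  simp only [pairH, gammaPE]; ring

/-- `⟪β, γ_PX⟫ = −(1−q)²(2−q)·(β_ux + β_xz)`. [folklore] -/
theorem pairH_gammaPX (q : ℝ) (β : Biv) : pairH q β (gammaPX q) = (1 - q) ^ 2 * (2 - q) * (-(β.ux + β.xz)) := by
  simp only [pairH, gammaPX]; ring

/-- `⟪β, γ_PY⟫ = −(1−q)²(2−q)·(β_uy + β_yz)`. [folklore] -/
theorem pairH_gammaPY (q : ℝ) (β : Biv) : pairH q β (gammaPY q) = (1 - q) ^ 2 * (2 - q) * (-(β.uy + β.yz)) := by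
  simp only [pairH, gammaPY]; ring

/-- `⟪β, γ_PV⟫ = (1−q)²(2−q)·(β_zv − β_uv)`. [folklore] -/
theorem pairH_gammaPV (q : ℝ) (β : Biv) : pairH q β (gammaPV q) = (1 - q) ^ 2 * (2 - q) * (β.zv - β.uv) := by
  simp only [pairH, gammaPV]; ring

/-- The face functional is the combination `γ_PV − γ_PX + γ_PY + γ_PE`. [folklore] -/
theorem gammaFace_eq (q : ℝ) : gammaFace q = Biv.add (Biv.add (gammaPV q) (Biv.smul (-1) (gammaPX q))) (Biv.add (gammaPY q) gammaPE) := by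
  ext <;> simp [gammaFace, gammaPE, gammaPX, gammaPY, gammaPV, Biv.add, Biv.smul]

/-- **Coordinate identity `E`**: `⟪imgA q F w, γ_PE⟫ = (1−q)²(2−q)·F_ac w_bc (F₀+F_ab) ŷ(w)`. [folklore] -/
theorem pairH_imgA_gammaPE (q : ℝ) (F w : V5) :
    pairH q (imgA q F w) gammaPE = (1 - q) ^ 2 * (2 - q) * (F.zac * w.zbc * (F.z0 + F.zab) * hy w) := by
  simp only [pairH, gammaPE, imgA, wedgeH, fanCombo, conv, edgeAC, detach, V5.total, hx, hy, hz]; ring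

/-- **Coordinate identity `x`**: `⟪imgA q F w, γ_PX⟫ = (1−q)²(2−q)·F_ac w_bc (F₀+F_ab) |w|`. [folklore] -/
theorem pairH_imgA_gammaPX (q : ℝ) (F w : V5) :
    pairH q (imgA q F w) (gammaPX q) = (1 - q) ^ 2 * (2 - q) * (F.zac * w.zbc * (F.z0 + F.zab) * w.total) := by
  simp only [pairH, gammaPX, imgA, wedgeH, fanCombo, conv, edgeAC, detach, V5.total, hx, hy, hz]; ring

/-- **Coordinate identity `y`**: `⟪imgA q F w, γ_PY⟫ = (1−q)²(2−q)·F_ac w_bc |F| ŷ(w)`. [folklore] -/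
theorem pairH_imgA_gammaPY (q : ℝ) (F w : V5) :
    pairH q (imgA q F w) (gammaPY q) = (1 - q) ^ 2 * (2 - q) * (F.zac * w.zbc * F.total * hy w) := by
  simp only [pairH, gammaPY, imgA, wedgeH, fanCombo, conv, edgeAC, detach, V5.total, hx, hy, hz]; ring

/-- **Coordinate identity `v`**: `⟪imgA q F w, γ_PV⟫ = (1−q)²(2−q)·F_ac w_bc |F| |w|`. [folklore] -/
theorem pairH_imgA_gammaPV (q : ℝ) (F w : V5) :
    pairH q (imgA q F w) (gammaPV q) = (1 - q) ^ 2 * (2 - q) * (F.zac * w.zbc * F.total * w.total) := by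
  simp only [pairH, gammaPV, imgA, wedgeH, fanCombo, conv, edgeAC, detach, V5.total, hx, hy, hz]; ring

/-- **The `v − y` functional**: `⟪imgA q F w, γ_PV − γ_PY⟫ = (1−q)²(2−q)·F_ac w_bc |F|·(|w| − ŷ w) ≥ 0`; it is in `OSDualS q` (`q ≤ 1`). [folklore] -/
theorem oSDualS_gammaPV_sub_gammaPY {q : ℝ} (hq1 : q ≤ 1) : OSDualS q (Biv.add (gammaPV q) (Biv.smul (-1) (gammaPY q))) := by
  intro F w hF hw
  have e : pairH q (imgA q F w) (Biv.add (gammaPV q) (Biv.smul (-1) (gammaPY q))) =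
      (1 - q) ^ 2 * (2 - q) * (F.zac * w.zbc * F.total * (w.zab + w.zbc + w.z1)) := by
    rw [pairH_comm, pairH_add_left, pairH_smul_left, pairH_comm q (gammaPV q), pairH_comm q (gammaPY q), pairH_imgA_gammaPV,
      pairH_imgA_gammaPY]
    simp only [V5.total, hy]; ring
  rw [e]
  obtain ⟨f0, fab, fac, fbc, f1⟩ := hF.valid.nonneg
  obtain ⟨w0, wab, wac, wbc, w1⟩ := hw.valid.nonneg
  have h1 : 0 ≤ 1 - q := sub_nonneg.2 hq1
  have h2 : 0 ≤ 2 - q := by linarith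
  have hFt : 0 ≤ F.total := by simp only [V5.total]; positivity
  positivity

/-- **All four coordinate functionals lie in `OSDualS q`** (`q ≤ 1`): the contraction of the cone with `e_u − e_z` lies in a closed simplicial cone.
[folklore] -/
theorem oSDualS_gammaP {q : ℝ} (hq1 : q ≤ 1) :
    OSDualS q gammaPE ∧ OSDualS q (gammaPX q) ∧ OSDualS q (gammaPY q) ∧ OSDualS q (gammaPV q) := by
  have h1 : 0 ≤ 1 - q := sub_nonneg.2 hq1
  have h2 : 0 ≤ 2 - q := by linarith
  have hFt : ∀ F : V5, F.Nonneg → 0 ≤ F.total := fun F hF => by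
    obtain ⟨f0, fab, fac, fbc, f1⟩ := hF; simp only [V5.total]; positivity
  have hyw : ∀ w : V5, w.Nonneg → 0 ≤ hy w := fun w hw => by
    obtain ⟨w0, wab, wac, wbc, w1⟩ := hw; simp only [hy]; positivity
  refine ⟨fun F w hF hw => ?_, fun F w hF hw => ?_, fun F w hF hw => ?_, fun F w hF hw => ?_⟩
  · rw [pairH_imgA_gammaPE]
    have := hyw w hw.valid.nonneg
    obtain ⟨f0, fab, fac, fbc, f1⟩ := hF.valid.nonneg; obtain ⟨w0, wab, wac, wbc, w1⟩ := hw.valid.nonneg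
    positivity
  · rw [pairH_imgA_gammaPX]
    have := hFt w hw.valid.nonneg
    obtain ⟨f0, fab, fac, fbc, f1⟩ := hF.valid.nonneg; obtain ⟨w0, wab, wac, wbc, w1⟩ := hw.valid.nonneg
    positivity
  · rw [pairH_imgA_gammaPY]
    have := hFt F hF.valid.nonneg; have := hyw w hw.valid.nonneg
    obtain ⟨f0, fab, fac, fbc, f1⟩ := hF.valid.nonneg; obtain ⟨w0, wab, wac, wbc, w1⟩ := hw.valid.nonneg
    positivity
  · rw [pairH_imgA_gammaPV]
    have := hFt F hF.valid.nonneg; have := hFt w hw.valid.nonneg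
    obtain ⟨f0, fab, fac, fbc, f1⟩ := hF.valid.nonneg; obtain ⟨w0, wab, wac, wbc, w1⟩ := hw.valid.nonneg
    positivity

/-- **The `e_zv`-margin of the `b`-spoke state is at most `y²`**: for `w = BC_y ∗ δ₀` (the rest `edgeBC y`) and `ε > y²`, the vector
`ι(w) − ε·e_zv` (with `ι(w) = imgA q fanInit (edgeBC y)` and `e_zv = ι(BC_1 δ₀)`) is NOT in the cone: it pairs to `(1−q)²(2−q)(y² − ε) < 0` with
`γ_PV − γ_PY` (`0 ≤ q < 1`).  Equivalently `(T_b + C)·ι(δ₀)` lies at best ON the boundary for every `C`. [folklore] -/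
theorem iotaBC_sub_ezv_not_mem {q y ε : ℝ} (hq1 : q < 1) (hε : y ^ 2 < ε) :
    Biv.add (imgA q fanInit (edgeBC y)) (Biv.smul (-ε) (imgA q fanInit (edgeBC 1))) ∉ osConeS q := by
  intro hmem
  have hval : pairH q (Biv.add (imgA q fanInit (edgeBC y)) (Biv.smul (-ε) (imgA q fanInit (edgeBC 1))))
      (Biv.add (gammaPV q) (Biv.smul (-1) (gammaPY q))) = (1 - q) ^ 2 * (2 - q) * (y ^ 2 - ε) := by
    rw [fanInit_eq]
    simp only [pairH, gammaPV, gammaPY, imgA, wedgeH, fanCombo, conv, edgeAC, edgeBC, detach, V5.total, hx, hy, hz, Biv.add, Biv.smul]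
    ring
  have h := hmem _ (oSDualS_gammaPV_sub_gammaPY hq1.le)
  rw [hval] at h
  have h1 : 0 < (1 - q) ^ 2 * (2 - q) := by
    have hq' : 0 < 1 - q := sub_pos.2 hq1
    have h2 : 0 < 2 - q := by linarith
    exact mul_pos (pow_pos hq' 2) h2
  nlinarith

/-- The shifted trivial corner `(T_b + C)·ι(δ₀) = (0, C, 0, C+1, C, 0, C+1, −(C+1), 0, C+2)` pairs to ZERO with `γ_PV − γ_PY`: like the cut vector
(`pairH_cutShift_gammaFace`), it is at best a boundary point of the cone. [folklore] -/
theorem pairH_shiftIota_gammaPV_sub_gammaPY (q C : ℝ) :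
    pairH q (⟨0, C, 0, C + 1, C, 0, C + 1, -(C + 1), 0, C + 2⟩ : Biv) (Biv.add (gammaPV q) (Biv.smul (-1) (gammaPY q))) = 0 := by
  simp only [pairH, gammaPV, gammaPY, Biv.add, Biv.smul]; ring

end ThreeApex

end FK

end Summit.CriticalPhenomena.PercolationContinuityZ3.Theorems
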